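import Literature.Computability.Complexity.MatchingAveraging
import HarnessLib

/-!
# BBCHPRRWZ Lemma 4.6 (case `d = 0`): the level sums of matching monomials are congruent to constants

Braun–Brown-Cohen–Huq–Pokutta–Raghavendra–Roy–Weitz–Zink, *The matching problem has no small
symmetric SDP*, Math. Program. 165 (2017), Lemma 4.6 with `d = 0` (the case used in Lemma 4.7):
`1 ≅_{(𝒫_n, k)} (n/2 choose k)⁻¹ Σ_{|M'| = k} x_{M'}`, i.e. the LEVEL SUM
`T_k = Σ_{M partial matching, |M| = k} x_M` is congruent to a constant in degree `k`.

We prove `levelSum_isCong_C` (`T_k ≅_k c_k` for explicit constants `c_0 = 1`,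
`c_{k+1} = c_k (n/2 - k)/(k+1)`, i.e. `c_k = (n/2 choose k)` for even `n`) by a degree-economical
variant of the printed averaging: the vertex equations give `Σ_e x_e ≅_1 n/2`
(`isCong_sum_X_const`, "a perfect matching has `n/2` edges"), and multiplying `T_k` by `Σ_e x_e`
and reducing with the Boolean and disjointness axioms (Lemma 4.4/4.5 style) yields
`(n/2) T_k ≅_{k+1} k T_k + (k+1) T_{k+1}` (`levelSum_recursion`), the factor `k + 1` being the
double count "each `(k+1)`-matching arises from `k + 1` pairs `(M, e)`" (`sum_sum_free_eq`).

## References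

* G. Braun et al., *The matching problem has no small symmetric SDP*, Math. Program. 165 (2017)
  643–662, Lemmas 4.5–4.7 (arXiv:1504.00703, p. 8). [BraunEtAl2016]
-/

noncomputable section

open MvPolynomial Finset

namespace Literature.Computability.Complexity

namespace Mod2

variable {n : ℕ}

/-! ### Partial matchings of size `k` and their level sums -/

/-- Decidability of "pairwise vertex-disjoint". [cite: BraunEtAl2016, §4.3 (p. 8)] -/
instance decidableIsPartialMatching (M : Finset (KnEdge n)) : Decidable (IsPartialMatching M) := by
  unfold IsPartialMatching; infer_instance

/-- The partial matchings of `K_n` with `k` edges. [cite: BraunEtAl2016, Lemma 4.6 (p. 8, "Σ_{|M'| = k}")] -/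
def PMk (n k : ℕ) : Finset (Finset (KnEdge n)) :=
  univ.filter fun M => IsPartialMatching M ∧ M.card = k

/-- Membership in `PMk`. [cite: BraunEtAl2016, Lemma 4.6 (p. 8)] -/
theorem mem_PMk {k : ℕ} {M : Finset (KnEdge n)} : M ∈ PMk n k ↔ IsPartialMatching M ∧ M.card = k := by
  simp [PMk]

/-- **The level sum** `T_k = Σ_{|M| = k} x_M` over the partial matchings with `k` edges.
[cite: BraunEtAl2016, Lemma 4.6 (p. 8)] -/
def levelSum (n k : ℕ) : MvPolynomial (KnEdge n) ℝ := ∑ M ∈ PMk n k, xM M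

/-- `T_0 = 1`. [cite: BraunEtAl2016, Lemma 4.6 (p. 8, "the start of the induction")] -/
theorem levelSum_zero : levelSum n 0 = 1 := by
  have : PMk n 0 = {∅} := by
    ext M
    rw [mem_PMk, mem_singleton, card_eq_zero]
    constructor
    · exact fun h => h.2
    · rintro rfl; exact ⟨fun e he => absurd he (by simp), rfl⟩
  rw [levelSum, this, sum_singleton, xM, prod_empty]

/-! ### `Σ_e x_e ≅_1 n/2` -/

/-- Double counting at the level of polynomials: `Σ_v Σ_{e ∋ v} x_e = 2 Σ_e x_e`.
[cite: BraunEtAl2016, §4.2 (p. 7, the vertex equations)] -/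
theorem sum_vertex_sums_X :
    ∑ v : Fin n, ∑ e ∈ univ.filter (fun e : KnEdge n => v ∈ (e : Sym2 (Fin n))), (X e : MvPolynomial (KnEdge n) ℝ) =
      2 • ∑ e : KnEdge n, X e := by
  classical
  calc ∑ v : Fin n, ∑ e ∈ univ.filter (fun e : KnEdge n => v ∈ (e : Sym2 (Fin n))), (X e : MvPolynomial (KnEdge n) ℝ)
      = ∑ v : Fin n, ∑ e : KnEdge n, (if v ∈ (e : Sym2 (Fin n)) then (X e : MvPolynomial (KnEdge n) ℝ) else 0) :=
        sum_congr rfl fun v _ => (sum_filter _ _)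
    _ = ∑ e : KnEdge n, ∑ v : Fin n, (if v ∈ (e : Sym2 (Fin n)) then (X e : MvPolynomial (KnEdge n) ℝ) else 0) :=
        sum_comm
    _ = ∑ e : KnEdge n, 2 • (X e : MvPolynomial (KnEdge n) ℝ) := by
        refine sum_congr rfl fun e _ => ?_
        rw [← sum_filter, sum_const, card_filter_mem_edge]
    _ = 2 • ∑ e : KnEdge n, X e := by rw [smul_sum]

/-- **A perfect matching has `n/2` edges, derivably in degree `1`**: `Σ_e x_e ≅_{(𝒫_n,1)} n/2`.
[cite: BraunEtAl2016, Lemma 4.6 (p. 8, the constant (n/2 choose k))] -/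
theorem isCong_sum_X_const :
    IsCong (system n) 1 (∑ e : KnEdge n, (X e : MvPolynomial (KnEdge n) ℝ)) (C ((n : ℝ) / 2)) := by
  classical
  -- `Σ_v S_v ≅_1 0` and `Σ_v S_v = 2 Σ_e x_e - n`
  have hgen : IsCong (system n) 1 (∑ v : Fin n, system n (Sum.inr (Sum.inr v)))
      (∑ _v : Fin n, (0 : MvPolynomial (KnEdge n) ℝ)) := by
    refine IsCong.sum fun v _ => isCong_generator_zero _ ?_
    rw [system_vertex]
    refine (totalDegree_sub _ _).trans (max_le ?_ (by simp))
    exact (totalDegree_finsetSum _ _).trans (Finset.sup_le fun e _ => (totalDegree_X e).le)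
  rw [sum_const_zero] at hgen
  have hsum : ∑ v : Fin n, system n (Sum.inr (Sum.inr v)) =
      C (2 : ℝ) * (∑ e : KnEdge n, (X e : MvPolynomial (KnEdge n) ℝ)) - C (n : ℝ) := by
    simp only [system_vertex, sum_sub_distrib, sum_const, card_univ, Fintype.card_fin]
    rw [sum_vertex_sums_X, nsmul_eq_mul, nsmul_eq_mul, mul_one, map_natCast, map_ofNat, Nat.cast_ofNat]
  rw [hsum] at hgen
  -- rescale: `Σ x_e = (1/2)((2 Σ x_e - n)) + n/2`
  have h2 := (hgen.mul_left (C (1 / 2 : ℝ)) (k := 0) (by rw [totalDegree_C])).add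
    (IsCong.refl (S := system n) (d := 1) (C ((n : ℝ) / 2)))
  have hl : C (1 / 2 : ℝ) * (C (2 : ℝ) * ∑ e : KnEdge n, (X e : MvPolynomial (KnEdge n) ℝ) - C (n : ℝ)) +
      C ((n : ℝ) / 2) = ∑ e : KnEdge n, X e := by
    rw [mul_sub, ← mul_assoc, ← map_mul, ← map_mul, show (1 / 2 : ℝ) * 2 = 1 by norm_num, map_one,
      one_mul, show (1 / 2 : ℝ) * n = n / 2 by ring, sub_add_cancel]
  rw [hl, mul_zero, zero_add] at h2
  exact h2

/-! ### Multiplying a matching monomial by a variable -/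

/-- `e ∈ M`: `x_M x_e ≅_{|M|+1} x_M` (Boolean axiom). [cite: BraunEtAl2016, Lemma 4.4 (p. 8, "x_e² ≅_2 x_e")] -/
theorem isCong_xM_mul_X_of_mem {M : Finset (KnEdge n)} {e : KnEdge n} (he : e ∈ M) :
    IsCong (system n) (M.card + 1) (xM M * X e) (xM M) := by
  classical
  have h := (isCong_X_pow e (k := 2) (by norm_num)).mul_right (xM (M.erase e)) (totalDegree_xM_le _)
  have hM : xM M = X e * xM (M.erase e) := by rw [xM, ← mul_prod_erase M _ he, xM]
  rw [hM, show X e * xM (M.erase e) * X e = X e ^ 2 * xM (M.erase e) by ring]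
  refine h.mono ?_
  rw [card_erase_of_mem he]
  have : 1 ≤ M.card := card_pos.2 ⟨e, he⟩
  omega

/-- `e ∉ M` meeting `V(M)`: `x_M x_e ≅_{|M|+1} 0` (disjointness axiom). [cite: BraunEtAl2016, Lemma 4.5 (proof)] -/
theorem isCong_xM_mul_X_of_touch {M : Finset (KnEdge n)} {e : KnEdge n} (he : e ∉ M)
    (ht : ∃ v ∈ verts M, v ∈ (e : Sym2 (Fin n))) : IsCong (system n) (M.card + 1) (xM M * X e) 0 := by
  classical
  obtain ⟨w, hw, hwe⟩ := ht
  obtain ⟨f, hfM, hwf⟩ := mem_verts.1 hw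
  have hfe : f ≠ e := fun h => he (h ▸ hfM)
  let p : {p : KnEdge n × KnEdge n //
      p.1 ≠ p.2 ∧ ∃ i : Fin n, i ∈ (p.1 : Sym2 (Fin n)) ∧ i ∈ (p.2 : Sym2 (Fin n))} :=
    ⟨(f, e), hfe, w, hwf, hwe⟩
  have hgen : IsCong (system n) 2 (X f * X e : MvPolynomial (KnEdge n) ℝ) 0 :=
    isCong_generator_zero (S := system n) (Sum.inr (Sum.inl p)) (by
      change (X f * X e : MvPolynomial (KnEdge n) ℝ).totalDegree ≤ 2
      exact (totalDegree_mul _ _).trans (by rw [totalDegree_X, totalDegree_X]))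
  have hrest := hgen.mul_right (xM (M.erase f)) (totalDegree_xM_le _)
  rw [zero_mul] at hrest
  have hxM : xM M * X e = X f * X e * xM (M.erase f) := by
    rw [xM, ← mul_prod_erase M _ hfM, xM]; ring
  rw [hxM]
  refine hrest.mono ?_
  rw [card_erase_of_mem hfM]
  have : 1 ≤ M.card := card_pos.2 ⟨f, hfM⟩
  omega

/-- The free edges for `M` (all of whose vertices are uncovered). [cite: BraunEtAl2016, Lemma 4.5 (p. 8)] -/
def freeEdges (M : Finset (KnEdge n)) : Finset (KnEdge n) :=
  univ.filter fun e => ∀ v ∈ verts M, v ∉ (e : Sym2 (Fin n))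

/-- Membership in `freeEdges`. [cite: BraunEtAl2016, Lemma 4.5 (p. 8)] -/
theorem mem_freeEdges {M : Finset (KnEdge n)} {e : KnEdge n} :
    e ∈ freeEdges M ↔ ∀ v ∈ verts M, v ∉ (e : Sym2 (Fin n)) := by
  simp [freeEdges]

/-- A free edge is not in `M` (an edge has a vertex). [cite: BraunEtAl2016, Lemma 4.5 (p. 8)] -/
theorem not_mem_of_mem_freeEdges {M : Finset (KnEdge n)} {e : KnEdge n} (he : e ∈ freeEdges M) :
    e ∉ M := by
  intro heM
  obtain ⟨s, hs⟩ := e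
  induction s using Sym2.ind with
  | _ a b =>
    exact mem_freeEdges.1 he a (mem_verts.2 ⟨_, heM, Sym2.mem_mk_left a b⟩) (Sym2.mem_mk_left a b)

/-- **`x_M · Σ_e x_e ≅_{|M|+1} |M| x_M + Σ_{e free} x_{M ∪ e}`.**
[cite: BraunEtAl2016, Lemmas 4.4–4.5 (p. 8)] -/
theorem isCong_xM_mul_sum_X (M : Finset (KnEdge n)) :
    IsCong (system n) (M.card + 1) (xM M * ∑ e : KnEdge n, X e)
      ((M.card : ℝ) • xM M + ∑ e ∈ freeEdges M, xM (insert e M)) := by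
  classical
  rw [mul_sum]
  -- split the edges into `M`, touching, free
  have hsplit : (univ : Finset (KnEdge n)) =
      M ∪ (univ.filter fun e : KnEdge n => e ∉ M ∧ ∃ v ∈ verts M, v ∈ (e : Sym2 (Fin n))) ∪ freeEdges M := by
    ext e
    simp only [mem_univ, mem_union, mem_filter, true_and, mem_freeEdges, true_iff]
    by_cases h1 : e ∈ M
    · exact Or.inl (Or.inl h1)
    · by_cases h2 : ∃ v ∈ verts M, v ∈ (e : Sym2 (Fin n))
      · exact Or.inl (Or.inr ⟨h1, h2⟩)
      · push Not at h2
        exact Or.inr h2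
  have hd1 : Disjoint M (univ.filter fun e : KnEdge n => e ∉ M ∧ ∃ v ∈ verts M, v ∈ (e : Sym2 (Fin n))) :=
    disjoint_left.2 fun e he he' => (mem_filter.1 he').2.1 he
  have hd2 : Disjoint (M ∪ (univ.filter fun e : KnEdge n => e ∉ M ∧ ∃ v ∈ verts M, v ∈ (e : Sym2 (Fin n))))
      (freeEdges M) := by
    refine disjoint_left.2 fun e he hef => ?_
    rcases mem_union.1 he with h | h
    · exact not_mem_of_mem_freeEdges hef h
    · obtain ⟨-, v, hv, hve⟩ := (mem_filter.1 h).2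
      exact mem_freeEdges.1 hef v hv hve
  rw [hsplit, sum_union hd2, sum_union hd1]
  have h1 : IsCong (system n) (M.card + 1) (∑ e ∈ M, xM M * X e) (∑ _e ∈ M, xM M) :=
    IsCong.sum fun e he => isCong_xM_mul_X_of_mem he
  have h2 : IsCong (system n) (M.card + 1)
      (∑ e ∈ univ.filter (fun e : KnEdge n => e ∉ M ∧ ∃ v ∈ verts M, v ∈ (e : Sym2 (Fin n))), xM M * X e)
      (∑ _e ∈ univ.filter (fun e : KnEdge n => e ∉ M ∧ ∃ v ∈ verts M, v ∈ (e : Sym2 (Fin n))),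
        (0 : MvPolynomial (KnEdge n) ℝ)) :=
    IsCong.sum fun e he => isCong_xM_mul_X_of_touch (mem_filter.1 he).2.1 (mem_filter.1 he).2.2
  have h3 : IsCong (system n) (M.card + 1) (∑ e ∈ freeEdges M, xM M * X e)
      (∑ e ∈ freeEdges M, xM (insert e M)) :=
    IsCong.sum fun e he => by
      rw [xM_insert (not_mem_of_mem_freeEdges he), mul_comm]
      exact IsCong.refl _
  have h := (h1.add h2).add h3
  rw [sum_const, sum_const_zero, add_zero, ← Nat.cast_smul_eq_nsmul ℝ] at h
  exact h

/-! ### Double counting and the recursion -/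

/-- Removing an edge from a partial matching leaves a partial matching for which the edge is free.
[cite: BraunEtAl2016, Lemma 4.6 (proof, "the number of ways to choose")] -/
theorem mem_freeEdges_erase {M : Finset (KnEdge n)} (hM : IsPartialMatching M) {e : KnEdge n}
    (he : e ∈ M) : e ∈ freeEdges (M.erase e) := by
  rw [mem_freeEdges]
  intro v hv hve
  obtain ⟨f, hf, hvf⟩ := mem_verts.1 hv
  obtain ⟨hfe, hfM⟩ := mem_erase.1 hf
  exact hM f hfM e he hfe v ⟨hvf, hve⟩

/-- Sub-matchings are matchings. [cite: BraunEtAl2016, §4.3 (p. 8)] -/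
theorem IsPartialMatching.erase {M : Finset (KnEdge n)} (hM : IsPartialMatching M) (e : KnEdge n) :
    IsPartialMatching (M.erase e) :=
  fun f hf g hg hfg v hv => hM f (mem_of_mem_erase hf) g (mem_of_mem_erase hg) hfg v hv

/-- Free edges at a vertex are free. [cite: BraunEtAl2016, Lemma 4.5 (p. 8)] -/
theorem isPartialMatching_insert_of_mem_freeEdges {M : Finset (KnEdge n)} (hM : IsPartialMatching M)
    {e : KnEdge n} (he : e ∈ freeEdges M) : IsPartialMatching (insert e M) := by
  intro f hf g hg hfg v ⟨hvf, hvg⟩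
  have hfree := mem_freeEdges.1 he
  rcases mem_insert.1 hf with rfl | hf' <;> rcases mem_insert.1 hg with rfl | hg'
  · exact hfg rfl
  · exact hfree v (mem_verts.2 ⟨g, hg', hvg⟩) hvf
  · exact hfree v (mem_verts.2 ⟨f, hf', hvf⟩) hvg
  · exact hM f hf' g hg' hfg v ⟨hvf, hvg⟩

/-- **Double counting**: `Σ_{|M| = k} Σ_{e free for M} x_{M ∪ e} = (k+1) · T_{k+1}` (each
`(k+1)`-matching `M'` arises from the `k + 1` pairs `(M' ∖ e, e)`, `e ∈ M'`).
[cite: BraunEtAl2016, Lemma 4.6 (proof, "the factor 2(k - d) accounts for the number of ways to choose a and u")] -/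
theorem sum_sum_free_eq (k : ℕ) :
    ∑ M ∈ PMk n k, ∑ e ∈ freeEdges M, xM (insert e M) = ((k + 1 : ℕ) : ℝ) • levelSum n (k + 1) := by
  classical
  -- rewrite both sides as sums over sigma types and match them by a bijection
  rw [levelSum, smul_sum]
  have hrhs : ∑ M' ∈ PMk n (k + 1), ((k + 1 : ℕ) : ℝ) • xM M' =
      ∑ M' ∈ PMk n (k + 1), ∑ _e ∈ M', xM M' := by
    refine sum_congr rfl fun M' hM' => ?_
    rw [sum_const, (mem_PMk.1 hM').2, ← Nat.cast_smul_eq_nsmul ℝ]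
  rw [hrhs, sum_sigma', sum_sigma']
  refine sum_bij' (fun p _ => ⟨insert p.2 p.1, p.2⟩) (fun q _ => ⟨q.1.erase q.2, q.2⟩) ?_ ?_ ?_ ?_ ?_
  · rintro ⟨M, e⟩ hp
    obtain ⟨hM, he⟩ := mem_sigma.1 hp
    obtain ⟨hpm, hcard⟩ := mem_PMk.1 hM
    refine mem_sigma.2 ⟨mem_PMk.2 ⟨isPartialMatching_insert_of_mem_freeEdges hpm he, ?_⟩, mem_insert_self _ _⟩
    rw [card_insert_of_notMem (not_mem_of_mem_freeEdges he), hcard]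
  · rintro ⟨M', e⟩ hq
    obtain ⟨hM', he⟩ := mem_sigma.1 hq
    obtain ⟨hpm, hcard⟩ := mem_PMk.1 hM'
    refine mem_sigma.2 ⟨mem_PMk.2 ⟨hpm.erase e, ?_⟩, mem_freeEdges_erase hpm he⟩
    rw [card_erase_of_mem he, hcard, Nat.add_sub_cancel]
  · rintro ⟨M, e⟩ hp
    obtain ⟨-, he⟩ := mem_sigma.1 hp
    simp [erase_insert (not_mem_of_mem_freeEdges he)]
  · rintro ⟨M', e⟩ hq
    obtain ⟨-, he⟩ := mem_sigma.1 hq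
    simp [insert_erase he]
  · rintro ⟨M, e⟩ _
    rfl

/-- **The recursion** `(n/2) T_k ≅_{k+1} k T_k + (k+1) T_{k+1}`.
[cite: BraunEtAl2016, Lemma 4.6 (proof)] -/
theorem levelSum_recursion (k : ℕ) :
    IsCong (system n) (k + 1) (((n : ℝ) / 2) • levelSum n k)
      ((k : ℝ) • levelSum n k + ((k + 1 : ℕ) : ℝ) • levelSum n (k + 1)) := by
  classical
  -- `(n/2) T_k ≅ T_k Σ_e x_e`
  have h1 : IsCong (system n) (k + 1) (((n : ℝ) / 2) • levelSum n k)
      (levelSum n k * ∑ e : KnEdge n, X e) := by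
    have h := (isCong_sum_X_const (n := n)).symm.mul_left (levelSum n k) (k := k) ?_
    · rw [add_comm] at h
      rw [show ((n : ℝ) / 2) • levelSum n k = levelSum n k * C ((n : ℝ) / 2) by
        rw [mul_comm, C_mul']]
      exact h
    · refine (totalDegree_finsetSum _ _).trans (Finset.sup_le fun M hM => ?_)
      rw [(mem_PMk.1 hM).2.symm]
      exact totalDegree_xM_le M
  refine h1.trans ?_
  -- expand monomial by monomial
  rw [levelSum, sum_mul, ← sum_sum_free_eq, smul_sum, ← sum_add_distrib]
  refine IsCong.sum fun M hM => ?_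
  have hk : M.card = k := (mem_PMk.1 hM).2
  have := isCong_xM_mul_sum_X (n := n) M
  rw [hk] at this
  exact this

/-- The constants `c_k`: `c_0 = 1`, `c_{k+1} = c_k (n/2 - k)/(k+1)` (`= (n/2 choose k)` for even `n`).
[cite: BraunEtAl2016, Lemma 4.6 (p. 8, "1/(n/2 - d choose k - d)")] -/
def levelConst (n : ℕ) : ℕ → ℝ
  | 0 => 1
  | k + 1 => levelConst n k * (((n : ℝ) / 2 - k) / (k + 1))

/-- **BBCHPRRWZ Lemma 4.6 (`d = 0`): `T_k ≅_{(𝒫_n, k)} c_k`** — the `k`-th level sum of matching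
monomials is congruent to a constant in degree `k`. [cite: BraunEtAl2016, Lemma 4.6 (p. 8)] -/
theorem levelSum_isCong_C : ∀ k : ℕ, IsCong (system n) k (levelSum n k) (C (levelConst n k))
  | 0 => by rw [levelSum_zero, levelConst, map_one]; exact IsCong.refl _
  | k + 1 => by
    have hrec := levelSum_recursion (n := n) k
    have hIH := (levelSum_isCong_C k).mono (Nat.le_succ k)
    -- `(k+1) T_{k+1} ≅ (n/2) T_k - k T_k ≅ (n/2 - k) c_k`
    have h1 : IsCong (system n) (k + 1) (((k + 1 : ℕ) : ℝ) • levelSum n (k + 1))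
        ((((n : ℝ) / 2) - k) • C (levelConst n k)) := by
      have h := hrec.symm.sub (hIH.smul (k : ℝ))
      rw [add_sub_cancel_left] at h
      refine h.trans ?_
      have h' := (hIH.smul ((n : ℝ) / 2)).sub (IsCong.refl (S := system n) (d := k + 1) ((k : ℝ) • C (levelConst n k)))
      rw [← sub_smul] at h'
      exact h'
    have h2 := h1.smul (1 / ((k : ℝ) + 1))
    have hk1 : ((k : ℝ) + 1) ≠ 0 := by positivity
    rw [smul_smul, Nat.cast_add, Nat.cast_one, one_div_mul_cancel hk1, one_smul, smul_smul,
      ← C_mul', ← map_mul] at h2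
    convert h2 using 2
    rw [levelConst]
    field_simp

end Mod2

end Literature.Computability.Complexity
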